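import Literature.Barriers.RiemannHypothesis.DeBrangesPositivityHE

/-!
# `DeBrangesShift.KernelTestOne` (stmt-RiemannHypothesis-1524): the `c = 1` kernel-test certificate (negative lane)

Helpers for the refutation `DeBrangesShiftKernelTestOne_refuted`
(`Theorems/DeBrangesShiftKernelTestOneRefutation.lean`); nothing here asserts a Theses decl — the main
export is `DeBrangesShiftKernelTestOne.Cert.exists_zero_kernelTest_neg` (kernel-decided certificate): a zero `ρ` of
`ξ` with `Re{conj ξ′(ρ) · ξ(ρ+2)} < 0`.

Route `DeBrangesShift` (negative-side route on de Branges' shift family `E_c(z) = ξ(½ + c − 2icz)`)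
files as support item `KernelTestOne` (stmt-RiemannHypothesis-1524) the calibration instance `c = 1`
of the Conrey–Li kernel test: `∀ ρ, ξ(ρ) = 0 → 0 ≤ Re{conj ξ′(ρ) · ξ(ρ + 2)}`.  It is **false**: at the
fourth zero `ρ₄ = ½ + iγ₄`, `γ₄ = 30.42487612585951…`, one has `Re{conj ξ′(ρ₄) · ξ(ρ₄ + 2)} < 0`
(normalised cosine `≈ −0.221`).  The proof is a kernel-checked interval certificate in the style of
`Literature/Barriers/RiemannHypothesis/DeBrangesPositivityHE.lean` (Conrey–Li's `c = ½` failure at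
zero 34), whose evaluator, zero bracket and slope bound are reused verbatim:

* **No `Γ`-numerics** (`re_conj_deriv_riemannXi_mul_shift_two`): with `ξ = A·ζ`,
  `A(s) = ½ s(s−1) Γ_ℝ(s)` (`xiFactor`), at a zero `ρ = ½ + iγ` of `ζ` one has `ξ′(ρ) = A(ρ)ζ′(ρ)` and,
  by `Γ_ℝ(s+2) = Γ_ℝ(s)·s/(2π)` (`Complex.Gammaℝ_add_two`) and `ρ(ρ−1) = −(γ²+¼)`,
  `conj A(ρ) · A(ρ+2) = (γ²+¼)|Γ_ℝ(ρ)|²/(64π) · G₈(γ)` with the polynomial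
  `G₈(γ) = −8ρ(ρ+1)(ρ+2) = (36γ² − 15) + (8γ³ − 46γ) i`; hence
  `Re{conj ξ′(ρ) ξ(ρ+2)} = c · Re{conj ζ′(ρ) · ζ(5/2 + iγ) · G₈(γ)}` with `c > 0`.
* **The certificate** (the hypothesis of `Cert.sound`, scale `2^80`, the tables of `ConreyLi2000Cert`;
  the boxes are literal terms, so the file introduces no definitions): with
  `t₁ = T1/2⁴⁸ = γ₄ − 2⁻³³ + O(2⁻⁴⁸)`, `t₂ = t₁ + 2⁻³²`: the twisted sign test
  `hi Re(ζ(½+it₁) · conj ζ(½+it₂)) < 0` brackets a zero `γ ∈ [t₁, t₂]`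
  (`exists_zero_Icc_of_re_mul_conj_neg'`), `ζ′(½+iγ)` lies in the slope box widened by
  `(t₂−t₁)·4(t₂+4)³` (`norm_deriv_riemannZeta_sub_slope_le`), `ζ(5/2+iγ)` in one box evaluation over
  `{5/2} × [t₁, t₂]`, and the product box `W` has `hi Re W < 0` (float value `Re W ≈ −5.6·10⁴`,
  `|W| ≈ 2.6·10⁵`).  `Cert.check_holds` is the kernel's verdict (`decide +kernel`).

Outcome for the route: the `c = 1` member of de Branges' family `𝓗(E_c)` fails axiom (3.1) through the
kernel test (with `KernelNecessity`), extending the catalogued barrier `DeBrangesPositivity` (`c = ½`,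
Conrey–Li 2000) to the scale `c = 1`, as the route's thesis predicts ("failures expected among the
first zeros": zeros 4, 6, 7, 9, 12 fail in floating point; zero 4 is certified here).

References: J. B. Conrey, X.-J. Li, *A note on some positivity conditions related to zeta and
L-functions*, IMRN 2000:18, 929–940 (arXiv:math/9812166), §3; H. M. Edwards, *Riemann's Zeta
Function* (1974), §6.4.
-/

open Complex Literature.NumberTheory.LFunctions
open Literature.Analysis.ValidatedNumerics.NumericsMP Literature.NumberTheory.LFunctions.ZetaNumerics
open Literature.Barriers.RiemannHypothesis
open scoped Real ComplexConjugate

set_option linter.dupNamespace false  -- the mandated namespace repeats `RiemannHypothesis`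

namespace Summit.RiemannHypothesis.RiemannHypothesis.Theorems

namespace DeBrangesShiftKernelTestOne

/-! ## 1. Reduction to `ζ`-data at shift `2` (no `Γ`-numerics) -/

/-- `ρ(ρ−1) = −(γ²+¼)` for `ρ = ½ + iγ`. -/
theorem rho_mul_rho_sub_one (γ : ℝ) :
    (1 / 2 + γ * I : ℂ) * ((1 / 2 + γ * I) - 1) = -(((γ ^ 2 + 1 / 4 : ℝ)) : ℂ) := by
  apply Complex.ext <;> simp [sq] <;> ring

/-- `−8ρ(ρ+1)(ρ+2) = (36γ² − 15) + (8γ³ − 46γ)i` for `ρ = ½ + iγ`. -/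
theorem neg_eight_mul_rho_prod (γ : ℝ) :
    -8 * ((1 / 2 + γ * I : ℂ) * ((1 / 2 + γ * I) + 1) * ((1 / 2 + γ * I) + 2)) =
      (((36 * γ ^ 2 - 15 : ℝ)) : ℂ) + (((8 * γ ^ 3 - 46 * γ : ℝ)) : ℂ) * I := by
  apply Complex.ext <;> simp [pow_succ] <;> ring

/-- The `Γ`-factors at shift `2`: `conj A(ρ) · A(ρ+2) = (γ²+¼)|Γ_ℝ(ρ)|²/(64π) · G₈(γ)` for `ρ = ½ + iγ`,
by `Γ_ℝ(s+2) = Γ_ℝ(s)s/(2π)` and `Γ_ℝ(ρ) · conj Γ_ℝ(ρ) = |Γ_ℝ(ρ)|²`. -/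
theorem conj_xiFactor_mul_xiFactor_add_two (γ : ℝ) :
    conj (xiFactor (1 / 2 + γ * I)) * xiFactor ((1 / 2 + γ * I) + 2) =
      ((((γ ^ 2 + 1 / 4) * Complex.normSq (Gammaℝ (1 / 2 + γ * I)) / (64 * π) : ℝ)) : ℂ) *
        ((((36 * γ ^ 2 - 15 : ℝ)) : ℂ) + (((8 * γ ^ 3 - 46 * γ : ℝ)) : ℂ) * I) := by
  have hG8 := neg_eight_mul_rho_prod γ
  have hρρ := rho_mul_rho_sub_one γ
  set ρ : ℂ := 1 / 2 + γ * I with hρ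
  have hconj : conj ρ = 1 - ρ := conj_half_add γ
  have hρ0 : ρ ≠ 0 := fun h ↦ by
    have := congrArg Complex.re h; simp [hρ] at this
  have hG2 : Gammaℝ (ρ + 2) = Gammaℝ ρ * ρ / 2 / π := Gammaℝ_add_two hρ0
  have e1 : conj (xiFactor ρ) = ρ * (ρ - 1) / 2 * conj (Gammaℝ ρ) := by
    unfold xiFactor
    rw [map_mul, map_div₀, map_mul, map_sub, map_one, hconj, map_ofNat]
    ring
  have hns : Gammaℝ ρ * conj (Gammaℝ ρ) = (Complex.normSq (Gammaℝ ρ) : ℂ) := Complex.mul_conj _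
  rw [e1]
  unfold xiFactor
  rw [hG2]
  calc ρ * (ρ - 1) / 2 * conj (Gammaℝ ρ) * ((ρ + 2) * (ρ + 2 - 1) / 2 * (Gammaℝ ρ * ρ / 2 / (π : ℂ)))
      = (ρ * (ρ - 1)) * (ρ * (ρ + 1) * (ρ + 2)) * (Gammaℝ ρ * conj (Gammaℝ ρ)) / (8 * (π : ℂ)) := by
        ring
    _ = (-(((γ ^ 2 + 1 / 4 : ℝ)) : ℂ)) * (ρ * (ρ + 1) * (ρ + 2)) *
          (Complex.normSq (Gammaℝ ρ) : ℂ) / (8 * (π : ℂ)) := by rw [hρρ, hns]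
    _ = _ := by
        rw [← hG8]
        push_cast
        ring

/-- **Reduction of the `c = 1` kernel-test quantity to `ζ`-data.** At a zero `ρ = ½ + iγ` (`γ > 0`)
of `ζ`: `Re{conj ξ'(ρ) · ξ(ρ+2)} = c · Re{conj ζ'(ρ) · ζ(5/2+iγ) · ((36γ²−15) + (8γ³−46γ)i)}` for some
`c > 0` (namely `c = (γ²+¼)|Γ_ℝ(ρ)|²/(64π)`). -/
theorem re_conj_deriv_riemannXi_mul_shift_two {γ : ℝ} (hγ : 0 < γ)
    (hz : riemannZeta (1 / 2 + γ * I) = 0) :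
    ∃ c : ℝ, 0 < c ∧
      (conj (deriv riemannXi (1 / 2 + γ * I)) * riemannXi ((1 / 2 + γ * I) + 2)).re =
        c * (conj (deriv riemannZeta (1 / 2 + γ * I)) * riemannZeta (5 / 2 + γ * I) *
              ((((36 * γ ^ 2 - 15 : ℝ)) : ℂ) + (((8 * γ ^ 3 - 46 * γ : ℝ)) : ℂ) * I)).re := by
  have hfac := conj_xiFactor_mul_xiFactor_add_two γ
  set ρ : ℂ := 1 / 2 + γ * I with hρ
  have hρpos : 0 < ρ.re := by simp [hρ]
  have hρ1 : ρ ≠ 1 := fun h ↦ by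
    have := congrArg Complex.im h; simp [hρ] at this; linarith
  have h2re : 0 < (ρ + 2).re := by simp [hρ]; norm_num
  have h21 : ρ + 2 ≠ 1 := fun h ↦ by
    have := congrArg Complex.im h; simp [hρ] at this; linarith
  have hd : deriv riemannXi ρ = xiFactor ρ * deriv riemannZeta ρ :=
    deriv_riemannXi_eq_of_zero hρpos hρ1 hz
  have hx : riemannXi (ρ + 2) = xiFactor (ρ + 2) * riemannZeta (ρ + 2) :=
    riemannXi_eq_xiFactor_mul h2re h21
  have h52 : ρ + 2 = 5 / 2 + γ * I := by rw [hρ]; ring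
  have hG0 : Gammaℝ ρ ≠ 0 := Gammaℝ_ne_zero_of_re_pos hρpos
  have hns_pos : 0 < Complex.normSq (Gammaℝ ρ) := Complex.normSq_pos.2 hG0
  refine ⟨(γ ^ 2 + 1 / 4) * Complex.normSq (Gammaℝ ρ) / (64 * π),
    div_pos (mul_pos (by positivity) hns_pos) (by positivity), ?_⟩
  have hmain : conj (deriv riemannXi ρ) * riemannXi (ρ + 2) =
      ((((γ ^ 2 + 1 / 4) * Complex.normSq (Gammaℝ ρ) / (64 * π) : ℝ)) : ℂ) *
        (conj (deriv riemannZeta ρ) * riemannZeta (5 / 2 + γ * I) *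
          ((((36 * γ ^ 2 - 15 : ℝ)) : ℂ) + (((8 * γ ^ 3 - 46 * γ : ℝ)) : ℂ) * I)) := by
    rw [hd, hx, map_mul]
    rw [show riemannZeta (ρ + 2) = riemannZeta (5 / 2 + γ * I) by rw [h52]]
    calc conj (xiFactor ρ) * conj (deriv riemannZeta ρ) *
          (xiFactor (ρ + 2) * riemannZeta (5 / 2 + γ * I))
        = (conj (xiFactor ρ) * xiFactor (ρ + 2)) *
            (conj (deriv riemannZeta ρ) * riemannZeta (5 / 2 + γ * I)) := by ring
      _ = _ := by rw [hfac]; ring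
  rw [hmain, Complex.re_ofReal_mul]

/-! ## 2. The certificate and its soundness (no definitions, no notations: the boxes are literal
terms over the tree's evaluator `zetaBoxK` and tables `ConreyLi2000Cert.tables`) -/

namespace Cert

open ConreyLi2000Cert (S tables S_pos mem_halfBox div_eq_mul_negI)

/-- `5/2 + it ∈ {5/2} × J` from `t ∈ J`. -/
lemma mem_box52 {t : ℝ} {J : MI} (ht : MI.mem S t J) : MC.mem S (5 / 2 + t * I) ⟨MI.ofFrac S 5 2, J⟩ := by
  refine ⟨?_, by simpa using ht⟩
  have := MI.mem_ofFrac S 5 (q := 2) two_pos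
  norm_num at this ⊢
  exact this

/-- `G₈(γ) = (36γ² − 15) + (8γ³ − 46γ) i` lies in the box built from `J ∋ γ` by interval arithmetic. -/
lemma mem_g8Box {γ : ℝ} {J : MI} (hγ : MI.mem S γ J) :
    MC.mem S ((((36 * γ ^ 2 - 15 : ℝ)) : ℂ) + (((8 * γ ^ 3 - 46 * γ : ℝ)) : ℂ) * I)
      ⟨((J.sqr S).mulInt 36).sub (MI.ofInt S 15),
       ((MI.mul S (J.sqr S) J).mulInt 8).sub (J.mulInt 46)⟩ := by
  refine ⟨?_, ?_⟩
  · have h := MI.mem_sub (MI.mem_mulInt (MI.mem_sqr S_pos hγ) 36) (MI.mem_ofInt S 15)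
    have hre : ((((36 * γ ^ 2 - 15 : ℝ)) : ℂ) + (((8 * γ ^ 3 - 46 * γ : ℝ)) : ℂ) * I).re =
        γ ^ 2 * ((36 : ℤ) : ℝ) - ((15 : ℤ) : ℝ) := by
      simp only [Complex.add_re, Complex.ofReal_re, Complex.mul_re, Complex.ofReal_im, Complex.I_re,
        Complex.I_im, mul_zero, sub_zero, zero_mul]
      push_cast
      ring
    rw [hre]
    exact h
  · have h := MI.mem_sub (MI.mem_mulInt (MI.mem_mul S_pos (MI.mem_sqr S_pos hγ) hγ) 8)
      (MI.mem_mulInt hγ 46)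
    have him : ((((36 * γ ^ 2 - 15 : ℝ)) : ℂ) + (((8 * γ ^ 3 - 46 * γ : ℝ)) : ℂ) * I).im =
        γ ^ 2 * γ * ((8 : ℤ) : ℝ) - γ * ((46 : ℤ) : ℝ) := by
      simp only [Complex.add_im, Complex.ofReal_im, Complex.mul_im, Complex.ofReal_re, Complex.I_re,
        Complex.I_im, mul_zero, mul_one, zero_add, add_zero]
      push_cast
      ring
    rw [him]
    exact h

/-- **Soundness of the certificate.** The hypothesis is the certificate check, a closed `Bool`
(discharged by the kernel in `exists_zero_kernelTest_neg`): with `t₁ = 8563841298918132/2⁴⁸`,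
`t₂ = 8563841298983668/2⁴⁸ = t₁ + 2⁻³²`, the tables build, the three evaluations `Z1 ∋ ζ(½+it₁)`,
`Z2 ∋ ζ(½+it₂)`, `Z3 ∋ ζ({5/2} × [t₁,t₂])` succeed, `hi Re(Z1 · conj Z2) < 0` (twisted sign test) and
`hi Re W < 0` for the product box `W = conj D · Z3 · G`, `D` = slope box `(Z2 − Z1)(−i)2³²` widened by
`4·35³·2⁴⁸ ≥ (t₂ − t₁)·4(t₂ + 4)³·S`, `G ∋ G₈(γ)`.  Conclusion: a zero `½ + iγ` of `ζ`, `γ > 30`, with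
`Re{conj ζ'(½+iγ) · ζ(5/2+iγ) · G₈(γ)} < 0`. -/
theorem sound
    (h : (match tables with
      | none => false
      | some T =>
        match zetaBoxK T ⟨MI.ofFrac S 1 2, MI.ofFrac S 8563841298918132 (2 ^ 48)⟩,
          zetaBoxK T ⟨MI.ofFrac S 1 2, MI.ofFrac S 8563841298983668 (2 ^ 48)⟩,
          zetaBoxK T ⟨MI.ofFrac S 5 2, MI.span (MI.ofFrac S 8563841298918132 (2 ^ 48)) (MI.ofFrac S 8563841298983668 (2 ^ 48))⟩ with
        | some Z1, some Z2, some Z3 =>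
          decide ((MC.mul S Z1 (MC.conj Z2)).re.hi < 0) &&
            decide ((MC.mul S (MC.mul S
              (MC.conj ((((Z2.sub Z1).mulNegI).mulInt (2 ^ 32)).widen (4 * 35 ^ 3 * 2 ^ 48))) Z3)
              ⟨(((MI.span (MI.ofFrac S 8563841298918132 (2 ^ 48)) (MI.ofFrac S 8563841298983668 (2 ^ 48))).sqr S).mulInt 36).sub
                  (MI.ofInt S 15),
                ((MI.mul S ((MI.span (MI.ofFrac S 8563841298918132 (2 ^ 48)) (MI.ofFrac S 8563841298983668 (2 ^ 48))).sqr S)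
                  (MI.span (MI.ofFrac S 8563841298918132 (2 ^ 48)) (MI.ofFrac S 8563841298983668 (2 ^ 48)))).mulInt 8).sub
                  ((MI.span (MI.ofFrac S 8563841298918132 (2 ^ 48)) (MI.ofFrac S 8563841298983668 (2 ^ 48))).mulInt 46)⟩).re.hi < 0)
        | _, _, _ => false) = true) :
    ∃ γ : ℝ, 30 < γ ∧ riemannZeta (1 / 2 + γ * I) = 0 ∧
        (conj (deriv riemannZeta (1 / 2 + γ * I)) * riemannZeta (5 / 2 + γ * I) *
          ((((36 * γ ^ 2 - 15 : ℝ)) : ℂ) + (((8 * γ ^ 3 - 46 * γ : ℝ)) : ℂ) * I)).re < 0 := by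
  -- the bracket `[t₁, t₂]`
  set t₁ : ℝ := ((8563841298918132 : ℤ) : ℝ) / 2 ^ 48 with ht₁
  set t₂ : ℝ := ((8563841298983668 : ℤ) : ℝ) / 2 ^ 48 with ht₂
  have t₂_sub_t₁ : t₂ - t₁ = ((2 : ℝ) ^ 32)⁻¹ := by rw [ht₁, ht₂]; norm_num
  have lt_t₁ : (30 : ℝ) < t₁ := by rw [ht₁]; norm_num
  have t₂_lt : t₂ < (31 : ℝ) := by rw [ht₂]; norm_num
  have t₁_lt_t₂ : t₁ < t₂ := by rw [ht₁, ht₂]; norm_num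
  have mem_t1I : MI.mem S t₁ (MI.ofFrac S 8563841298918132 (2 ^ 48)) := by
    have := MI.mem_ofFrac S 8563841298918132 (q := 2 ^ 48) (by positivity)
    rw [ht₁]
    convert this using 2
    push_cast
    ring
  have mem_t2I : MI.mem S t₂ (MI.ofFrac S 8563841298983668 (2 ^ 48)) := by
    have := MI.mem_ofFrac S 8563841298983668 (q := 2 ^ 48) (by positivity)
    rw [ht₂]
    convert this using 2
    push_cast
    ring
  split at h
  · exact absurd h Bool.false_ne_true
  · rename_i T hT
    split at h
    · rename_i Z1 Z2 Z3 hZ1 hZ2 hZ3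
      simp only [Bool.and_eq_true, decide_eq_true_eq] at h
      obtain ⟨hprod, hW⟩ := h
      have hV : T.Valid := mkTablesK_valid hT
      have hTS : T.S = S := mkTablesK_S hT
      have hne1 : ∀ t : ℝ, t₁ ≤ t → (1 / 2 : ℂ) + t * I ≠ 1 := fun t ht h ↦ by
        have := congrArg Complex.im h; simp at this; linarith [lt_t₁]
      -- the two values on the line
      have hz1 : MC.mem S (riemannZeta (1 / 2 + t₁ * I)) Z1 := by
        have hb : MC.mem T.S (1 / 2 + t₁ * I) ⟨MI.ofFrac S 1 2, MI.ofFrac S 8563841298918132 (2 ^ 48)⟩ := by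
          rw [hTS]; exact mem_halfBox mem_t1I
        have := mem_zetaBoxK hV hb (hne1 _ le_rfl) hZ1
        rwa [hTS] at this
      have hz2 : MC.mem S (riemannZeta (1 / 2 + t₂ * I)) Z2 := by
        have hb : MC.mem T.S (1 / 2 + t₂ * I) ⟨MI.ofFrac S 1 2, MI.ofFrac S 8563841298983668 (2 ^ 48)⟩ := by
          rw [hTS]; exact mem_halfBox mem_t2I
        have := mem_zetaBoxK hV hb (hne1 _ t₁_lt_t₂.le) hZ2
        rwa [hTS] at this
      -- twisted sign test: a zero on the line in `[t₁, t₂]`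
      have hneg : (riemannZeta (1 / 2 + t₁ * I) * conj (riemannZeta (1 / 2 + t₂ * I))).re < 0 :=
        MI.neg_of_hi_neg (MC.mem_mul S_pos hz1 (MC.mem_conj hz2)).1 hprod
      obtain ⟨γ, hγ, hzero⟩ := exists_zero_Icc_of_re_mul_conj_neg' (by linarith [lt_t₁])
        t₁_lt_t₂.le (by linarith [t₂_lt]) (by rw [t₂_sub_t₁]; norm_num) hneg
      refine ⟨γ, lt_of_lt_of_le lt_t₁ hγ.1, hzero, ?_⟩
      -- `ζ'(½ + iγ)` in the slope box
      have hD : MC.mem S (deriv riemannZeta (1 / 2 + γ * I))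
          ((((Z2.sub Z1).mulNegI).mulInt (2 ^ 32)).widen (4 * 35 ^ 3 * 2 ^ 48)) := by
        have hslope := norm_deriv_riemannZeta_sub_slope_le (by linarith [lt_t₁]) t₁_lt_t₂ hγ
        have hmem : MC.mem S ((riemannZeta (1 / 2 + t₂ * I) - riemannZeta (1 / 2 + t₁ * I)) /
            ((t₂ - t₁ : ℝ) * I)) (((Z2.sub Z1).mulNegI).mulInt (2 ^ 32)) := by
          have := MC.mem_mulInt (MC.mem_mulNegI (MC.mem_sub hz2 hz1)) (2 ^ 32)
          rwa [t₂_sub_t₁, div_eq_mul_negI]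
        apply MC.mem_widen hmem
        calc ‖deriv riemannZeta (1 / 2 + γ * I) -
                (riemannZeta (1 / 2 + t₂ * I) - riemannZeta (1 / 2 + t₁ * I)) / ((t₂ - t₁ : ℝ) * I)‖ * S
            ≤ (t₂ - t₁) * (4 * (t₂ + 4) ^ 3) * S :=
              mul_le_mul_of_nonneg_right hslope (by positivity)
          _ ≤ ((4 * 35 ^ 3 * 2 ^ 48 : ℤ) : ℝ) := by
              rw [t₂_sub_t₁]
              have ht : t₂ + 4 ≤ 35 := by linarith [t₂_lt]
              have ht0 : (0 : ℝ) ≤ t₂ + 4 := by linarith [lt_t₁, t₁_lt_t₂]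
              have h3 : (t₂ + 4) ^ 3 ≤ (35 : ℝ) ^ 3 := pow_le_pow_left₀ ht0 ht 3
              have hS : ((S : ℕ) : ℝ) = 2 ^ 80 := by unfold S; norm_num
              rw [hS]
              push_cast
              linarith [h3]
      -- `ζ(5/2 + iγ) ∈ Z3`
      have hγI : MI.mem S γ (MI.span (MI.ofFrac S 8563841298918132 (2 ^ 48)) (MI.ofFrac S 8563841298983668 (2 ^ 48))) :=
        MI.mem_span mem_t1I mem_t2I hγ.1 hγ.2
      have hz3 : MC.mem S (riemannZeta (5 / 2 + γ * I)) Z3 := by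
        have hb : MC.mem T.S (5 / 2 + γ * I)
            ⟨MI.ofFrac S 5 2, MI.span (MI.ofFrac S 8563841298918132 (2 ^ 48)) (MI.ofFrac S 8563841298983668 (2 ^ 48))⟩ := by
          rw [hTS]; exact mem_box52 hγI
        have hne : (5 / 2 : ℂ) + γ * I ≠ 1 := fun h ↦ by
          have := congrArg Complex.im h; simp at this; linarith [lt_t₁, hγ.1]
        have := mem_zetaBoxK hV hb hne hZ3
        rwa [hTS] at this
      -- the final product
      have hWmem := MC.mem_mul S_pos (MC.mem_mul S_pos (MC.mem_conj hD) hz3) (mem_g8Box hγI)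
      exact MI.neg_of_hi_neg hWmem.1 hW
    · exact absurd h Bool.false_ne_true

/-! ## 3. The kernel's verdict and the failing zero -/

/-- **The kernel accepts the certificate** (`decide +kernel`: tables, three evaluations of `ζ` at
scale `2^80`, two sign checks; no compiler axiom).  The statement is the hypothesis of `sound`, verbatim. -/
theorem check_holds :
    (match tables with
      | none => false
      | some T =>
        match zetaBoxK T ⟨MI.ofFrac S 1 2, MI.ofFrac S 8563841298918132 (2 ^ 48)⟩,
          zetaBoxK T ⟨MI.ofFrac S 1 2, MI.ofFrac S 8563841298983668 (2 ^ 48)⟩,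
          zetaBoxK T ⟨MI.ofFrac S 5 2, MI.span (MI.ofFrac S 8563841298918132 (2 ^ 48)) (MI.ofFrac S 8563841298983668 (2 ^ 48))⟩ with
        | some Z1, some Z2, some Z3 =>
          decide ((MC.mul S Z1 (MC.conj Z2)).re.hi < 0) &&
            decide ((MC.mul S (MC.mul S
              (MC.conj ((((Z2.sub Z1).mulNegI).mulInt (2 ^ 32)).widen (4 * 35 ^ 3 * 2 ^ 48))) Z3)
              ⟨(((MI.span (MI.ofFrac S 8563841298918132 (2 ^ 48)) (MI.ofFrac S 8563841298983668 (2 ^ 48))).sqr S).mulInt 36).sub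
                  (MI.ofInt S 15),
                ((MI.mul S ((MI.span (MI.ofFrac S 8563841298918132 (2 ^ 48)) (MI.ofFrac S 8563841298983668 (2 ^ 48))).sqr S)
                  (MI.span (MI.ofFrac S 8563841298918132 (2 ^ 48)) (MI.ofFrac S 8563841298983668 (2 ^ 48)))).mulInt 8).sub
                  ((MI.span (MI.ofFrac S 8563841298918132 (2 ^ 48)) (MI.ofFrac S 8563841298983668 (2 ^ 48))).mulInt 46)⟩).re.hi < 0)
        | _, _, _ => false) = true := by
  decide +kernel

/-- **The `c = 1` kernel test fails at a zero of `ξ`**: there is a zero `ρ = ½ + iγ` of `ξ`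
(`γ ∈ [t₁, t₁ + 2⁻³²] ⊂ (30, 31)`, the fourth zero of `ζ`) with `Re{conj ξ'(ρ) · ξ(ρ + 2)} < 0`.
(`sound` applied to the kernel's verdict `check_holds`). -/
theorem exists_zero_kernelTest_neg :
    ∃ ρ : ℂ, riemannXi ρ = 0 ∧ (conj (deriv riemannXi ρ) * riemannXi (ρ + 2)).re < 0 := by
  obtain ⟨γ, h30, hz, hneg⟩ := sound check_holds
  refine ⟨1 / 2 + γ * I, ?_, ?_⟩
  · have hne : (1 / 2 : ℂ) + γ * I ≠ 1 := fun h ↦ by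
      have := congrArg Complex.im h; simp at this; linarith
    rw [riemannXi_eq_xiFactor_mul (by simp) hne, hz, mul_zero]
  · obtain ⟨c, hc, heq⟩ := re_conj_deriv_riemannXi_mul_shift_two (by linarith) hz
    rw [heq]
    exact mul_neg_of_pos_of_neg hc hneg

end Cert

end DeBrangesShiftKernelTestOne

end Summit.RiemannHypothesis.RiemannHypothesis.Theorems
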